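import Literature.NumberTheory.Automorphic.UnitaryGroupTorusCoveringWeights
import Literature.MeasureTheory.Measure.TranslationInvariantRealLine
import HarnessLib

/-!
# The window integral on the adelic torus of `U(J_N)`: against a covering weight of `T(F)`, the Haar mass
# of `{T < H ≤ T'}` is `C · (log T' − log T)` (ray invariance ⇒ a translation-invariant measure on `ℝ`)
(Arthur, *The trace formula in invariant form*, Ann. of Math. 114 (1981), §2: `J^T` is a polynomial in `T`,
the `T`-dependence being the volume of a truncated torus quotient; Rogawski (1990), §2.1 p. 12)

Topic `NumberTheory/Automorphic`; namespace `Literature.NumberTheory.Automorphic.UnitaryGroup`. THEOREMS ONLY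
over accepted tree modules: no definition, no named fact, no instance, no notation, no `sorry`. Piece (L2-dT)
of the road to the T1-qs law ★ `UnitaryGroup.TruncatedTracePolynomial`: after ★ L2-a
(`truncatedKernel_sub_truncatedKernel`), unfolding and the Iwasawa/thin-set integration (★ H10a
`UnitaryGroupBorelThinSetIntegral`), `J^{T'}(f) − J^T(f)` is a constant times
`∫⁻_{T(𝔸)} w(t) · 1_{T < H(t) ≤ T'} dμ_T` for a covering weight `w` of the rational torus `T(F)` acting on
`T(𝔸) = torusInBorel F E c N` (★ `Literature.MeasureTheory.Group.IsCoveringWeight`: `Σ_{τ ∈ T(F)} w(τ t) = 1`).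
THIS FILE: that integral is `C · (log T' − log T)`.

THE ARGUMENT (no fundamental domain of `T(F)`, no polar decomposition of the idele class group).
For measurable `φ ≥ 0` on `ℝ≥0` put `Λ_w(φ) = ∫⁻ w(t) φ(H(t)) dμ_T`. (i) `t ↦ φ(H t)` is `T(F)`-invariant
(product formula ★ `borelHeight_rational_borel_mul`), so `Λ_w` does not depend on the covering weight `w`
(★ `lintegral_mul_eq_of_coveringSum_eq`). (ii) `T(𝔸)` is abelian, so the translate `t ↦ w(a t)` of a covering
weight is a covering weight; with (i) and left invariance of `μ_T`, `Λ_w(φ) = Λ_w(φ(H(a ·)))`-type identity: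
`∫⁻ w(t) φ(H t) = ∫⁻ w(t) φ(H(a t))` for every `a ∈ T(𝔸)`. (iii) Along a ray `ρ` with `H(ρ(s) t) = e^{κs} H(t)`
(`κ > 0`; hypotheses-first, as in ★ H10b `setLIntegral_rpow_neg_borelHeight_lt_top`) the push-forward
`L = (log ∘ H)_*(w μ_T)` is therefore a translation-invariant Borel measure on `ℝ`; it is finite on `(0, 1]`
as soon as a torus Siegel set `S ⊆ ρ(ℝ) · 𝔎` (`𝔎` compact) meets every `T(F)`-orbit (★ domination
`lintegral_mul_le_inv_mul_setLIntegral_of_le_coveringSum_indicator`). (iv) Hence `L = L(0,1] · Lebesgue`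
(★ `Literature.MeasureTheory.Measure.measure_Ioc_eq_mul_of_forall_map_add_eq`, B-p10) and
`∫⁻ w · 1_{T<H≤T'} dμ_T = L(log T, log T'] = C (log T' − log T)`.

* (§1–§2 = companion ★ `UnitaryGroupTorusCoveringWeights`: `Γ_T := (rationalBorel F E c N).subgroupOf (torusInBorel F E c N)`,
  independence of the weight `lintegral_weight_mul_comp_borelHeight_eq`, translation
  `lintegral_weight_mul_comp_borelHeight_mul_left`.)
* §3 `lintegral_indicator_comp_borelHeight_mul_weight_le` — domination by a torus Siegel set;
  `exists_isCompact_siegel_inter_window_subset` — height windows of `ρ(ℝ) · 𝔎` are relatively compact.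
* §4 **`exists_lintegral_weight_mul_indicator_window_eq`** — THE WINDOW INTEGRAL `= C · (log T' − log T)`.

## References

* J. Arthur, *The trace formula in invariant form*, Ann. of Math. 114 (1981), §2 [Arthur1981TraceFormulaInvariantForm].
* J. D. Rogawski, *Automorphic Representations of Unitary Groups in Three Variables*, Annals of Mathematics
  Studies 123 (1990), §2.1 (p. 12) [Rogawski1990].
* A. Weil, *L'intégration dans les groupes topologiques* (1940), §9 (weights on quotients).
-/

set_option autoImplicit false

noncomputable section

open MeasureTheory Measure NumberField Set Literature.MeasureTheory.Group
open scoped NNReal ENNReal Pointwise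

namespace Literature.NumberTheory.Automorphic

namespace UnitaryGroup

variable {F E : Type} [Field F] [NumberField F] [Field E] [NumberField E] [Algebra F E]
  {c : E ≃ₐ[F] E} {N : ℕ}

/-! ## §3 Domination by a torus Siegel set: the windows have finite mass -/

section Window

variable [NeZero N] [MeasurableSpace (quasiSplit F E c N).Adelic] [BorelSpace (quasiSplit F E c N).Adelic]

/-- **Domination by a covering set**: if a measurable `S ⊆ T(𝔸_F)` meets every `T(F)`-orbit, then for every
covering weight `w` of `T(F)` and every measurable `A ⊆ ℝ≥0`,
`∫⁻ 1_{H ∈ A}(t) w(t) dμ_T ≤ μ_T(S ∩ {H ∈ A})` (★ `lintegral_mul_le_inv_mul_setLIntegral_of_le_coveringSum_indicator`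
with `c₀ = 1`). [cite: Arthur1981TraceFormulaInvariantForm, §2] -/
theorem lintegral_indicator_comp_borelHeight_mul_weight_le (μT : Measure (torusInBorel F E c N))
    [μT.IsMulLeftInvariant] {w : torusInBorel F E c N → ℝ≥0∞}
    (hw : IsCoveringWeight ((rationalBorel F E c N).subgroupOf (torusInBorel F E c N)) w)
    {S : Set (torusInBorel F E c N)} (hSm : MeasurableSet S)
    (hcov : ∀ t : torusInBorel F E c N,
      ∃ τ : (rationalBorel F E c N).subgroupOf (torusInBorel F E c N), τ • t ∈ S)
    {A : Set ℝ≥0} (hA : MeasurableSet A) :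
    ∫⁻ t, {t : torusInBorel F E c N |
        borelHeight (((t : torusInBorel F E c N) : borelAdelic F E c N) : (quasiSplit F E c N).Adelic) ∈ A}.indicator
        1 t * w t ∂μT ≤
      μT (S ∩ {t : torusInBorel F E c N |
        borelHeight (((t : torusInBorel F E c N) : borelAdelic F E c N) : (quasiSplit F E c N).Adelic) ∈ A}) := by
  haveI := measurableConstSMul_rationalTorusInBorel (F := F) (E := E) (c := c) (N := N)
  haveI := smulInvariantMeasure_rationalTorusInBorel (F := F) (E := E) (c := c) (N := N) μT
  haveI := countable_rationalTorusInBorel (F := F) (E := E) (c := c) (N := N)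
  have hHm : Measurable fun t : torusInBorel F E c N =>
      borelHeight (((t : torusInBorel F E c N) : borelAdelic F E c N) : (quasiSplit F E c N).Adelic) :=
    measurable_borelHeight.comp (measurable_subtype_coe.comp measurable_subtype_coe)
  have hWm : MeasurableSet {t : torusInBorel F E c N |
      borelHeight (((t : torusInBorel F E c N) : borelAdelic F E c N) : (quasiSplit F E c N).Adelic) ∈ A} :=
    hHm hA
  have hF : Measurable ({t : torusInBorel F E c N |
      borelHeight (((t : torusInBorel F E c N) : borelAdelic F E c N) : (quasiSplit F E c N).Adelic) ∈ A}.indicator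
      (1 : torusInBorel F E c N → ℝ≥0∞)) := measurable_one.indicator hWm
  have hFinv : ∀ (τ : (rationalBorel F E c N).subgroupOf (torusInBorel F E c N)) (t : torusInBorel F E c N),
      {t : torusInBorel F E c N |
        borelHeight (((t : torusInBorel F E c N) : borelAdelic F E c N) : (quasiSplit F E c N).Adelic) ∈ A}.indicator
        (1 : torusInBorel F E c N → ℝ≥0∞) (τ • t) =
      {t : torusInBorel F E c N |
        borelHeight (((t : torusInBorel F E c N) : borelAdelic F E c N) : (quasiSplit F E c N).Adelic) ∈ A}.indicator
        (1 : torusInBorel F E c N → ℝ≥0∞) t := by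
    intro τ t
    by_cases ht : t ∈ {t : torusInBorel F E c N |
        borelHeight (((t : torusInBorel F E c N) : borelAdelic F E c N) : (quasiSplit F E c N).Adelic) ∈ A}
    · have ht' : τ • t ∈ {t : torusInBorel F E c N |
          borelHeight (((t : torusInBorel F E c N) : borelAdelic F E c N) : (quasiSplit F E c N).Adelic) ∈ A} := by
        rw [Set.mem_setOf_eq, borelHeight_rationalTorusInBorel_smul]; exact ht
      rw [Set.indicator_of_mem ht, Set.indicator_of_mem ht']
      rfl
    · have ht' : τ • t ∉ {t : torusInBorel F E c N |
          borelHeight (((t : torusInBorel F E c N) : borelAdelic F E c N) : (quasiSplit F E c N).Adelic) ∈ A} := by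
        rw [Set.mem_setOf_eq, borelHeight_rationalTorusInBorel_smul]; exact ht
      rw [Set.indicator_of_notMem ht, Set.indicator_of_notMem ht']
  have hcov' : ∀ t : torusInBorel F E c N,
      (1 : ℝ≥0∞) ≤ coveringSum ((rationalBorel F E c N).subgroupOf (torusInBorel F E c N)) (S.indicator 1) t := by
    intro t
    obtain ⟨τ, hτ⟩ := hcov t
    rw [coveringSum_apply]
    calc (1 : ℝ≥0∞) = S.indicator 1 (τ • t) := by rw [Set.indicator_of_mem hτ, Pi.one_apply]
      _ ≤ ∑' γ : (rationalBorel F E c N).subgroupOf (torusInBorel F E c N), S.indicator 1 (γ • t) :=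
          ENNReal.le_tsum τ
  have h := lintegral_mul_le_inv_mul_setLIntegral_of_le_coveringSum_indicator μT hF hFinv hw.measurable
    (fun t => (hw.coveringSum_eq t).le) hSm one_ne_zero ENNReal.one_ne_top hcov'
  rw [inv_one, one_mul, lintegral_indicator hWm] at h
  simp only [Pi.one_apply, setLIntegral_one, Measure.restrict_apply hWm] at h
  rw [Set.inter_comm] at h
  exact h

omit [MeasurableSpace (quasiSplit F E c N).Adelic] [BorelSpace (quasiSplit F E c N).Adelic] in
/-- **A height window of a torus Siegel set is relatively compact**: if `S ⊆ ρ(ℝ) · 𝔎` with `𝔎` compact and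
the height is homogeneous along the ray `ρ` (`H(ρ(s) t) = e^{κs} H(t)`, `κ > 0`), then `S ∩ {e^a < H ≤ e^b}`
lies in the compact set `ρ([s₁, s₂]) · 𝔎` for suitable `s₁ ≤ s₂` (the extreme values of `H` on `𝔎`).
[cite: Arthur1981TraceFormulaInvariantForm, §2] -/
theorem exists_isCompact_siegel_inter_window_subset {𝔎 : Set (torusInBorel F E c N)} (h𝔎 : IsCompact 𝔎)
    {ρ : ℝ → torusInBorel F E c N} (hρc : Continuous ρ) {κ : ℝ} (hκ : 0 < κ)
    (hH : ∀ (s : ℝ) (t : torusInBorel F E c N),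
      (borelHeight (((ρ s * t : torusInBorel F E c N) : borelAdelic F E c N) : (quasiSplit F E c N).Adelic) : ℝ) =
        Real.exp (κ * s) * borelHeight (((t : torusInBorel F E c N) : borelAdelic F E c N) : (quasiSplit F E c N).Adelic))
    {S : Set (torusInBorel F E c N)} (hS : S ⊆ Set.range ρ * 𝔎) (a b : ℝ) :
    ∃ K : Set (torusInBorel F E c N), IsCompact K ∧
      S ∩ {t : torusInBorel F E c N |
        Real.exp a < (borelHeight (((t : torusInBorel F E c N) : borelAdelic F E c N) :
          (quasiSplit F E c N).Adelic) : ℝ) ∧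
        (borelHeight (((t : torusInBorel F E c N) : borelAdelic F E c N) :
          (quasiSplit F E c N).Adelic) : ℝ) ≤ Real.exp b} ⊆ K := by
  haveI : T2Space (borelAdelic F E c N) := t2Space_borelAdelic
  rcases 𝔎.eq_empty_or_nonempty with h0 | hne
  · refine ⟨∅, isCompact_empty, ?_⟩
    have hS0 : S = ∅ := Set.subset_empty_iff.1 (by simpa [h0] using hS)
    simp [hS0]
  -- extreme values of the continuous positive height on the compact `𝔎`
  have hcont : Continuous fun t : torusInBorel F E c N =>
      (borelHeight (((t : torusInBorel F E c N) : borelAdelic F E c N) : (quasiSplit F E c N).Adelic) : ℝ) :=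
    NNReal.continuous_coe.comp
      (continuous_borelHeight.comp (continuous_subtype_val.comp continuous_subtype_val))
  obtain ⟨k₀, hk₀, hmin⟩ := h𝔎.exists_isMinOn hne hcont.continuousOn
  obtain ⟨k₁, hk₁, hmax⟩ := h𝔎.exists_isMaxOn hne hcont.continuousOn
  set m : ℝ := (borelHeight (((k₀ : torusInBorel F E c N) : borelAdelic F E c N) :
    (quasiSplit F E c N).Adelic) : ℝ) with hm
  set M : ℝ := (borelHeight (((k₁ : torusInBorel F E c N) : borelAdelic F E c N) :
    (quasiSplit F E c N).Adelic) : ℝ) with hM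
  have hm0 : 0 < m := NNReal.coe_pos.2 (borelHeight_pos _)
  have hM0 : 0 < M := NNReal.coe_pos.2 (borelHeight_pos _)
  set s₁ : ℝ := (a - Real.log M) / κ with hs₁
  set s₂ : ℝ := (b - Real.log m) / κ with hs₂
  refine ⟨(fun p : ℝ × torusInBorel F E c N => ρ p.1 * p.2) '' (Set.Icc s₁ s₂ ×ˢ 𝔎),
    (isCompact_Icc.prod h𝔎).image ((hρc.comp continuous_fst).mul continuous_snd), ?_⟩
  rintro t ⟨htS, hta, htb⟩
  obtain ⟨x, ⟨s, rfl⟩, k, hk, rfl⟩ := hS htS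
  refine ⟨(s, k), Set.mk_mem_prod ?_ hk, rfl⟩
  have hHk : m ≤ (borelHeight (((k : torusInBorel F E c N) : borelAdelic F E c N) :
      (quasiSplit F E c N).Adelic) : ℝ) := hmin hk
  have hHk' : (borelHeight (((k : torusInBorel F E c N) : borelAdelic F E c N) :
      (quasiSplit F E c N).Adelic) : ℝ) ≤ M := hmax hk
  have hHkpos : 0 < (borelHeight (((k : torusInBorel F E c N) : borelAdelic F E c N) :
      (quasiSplit F E c N).Adelic) : ℝ) := NNReal.coe_pos.2 (borelHeight_pos _)
  change Real.exp a < (borelHeight ((((ρ s * k : torusInBorel F E c N)) : borelAdelic F E c N) :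
      (quasiSplit F E c N).Adelic) : ℝ) at hta
  change (borelHeight ((((ρ s * k : torusInBorel F E c N)) : borelAdelic F E c N) :
      (quasiSplit F E c N).Adelic) : ℝ) ≤ Real.exp b at htb
  rw [hH s k] at hta htb
  -- `a < κ s + log H(k) ≤ κ s + log M` and `κ s + log m ≤ κ s + log H(k) ≤ b`
  have h1 : a < κ * s + Real.log M := by
    have := Real.log_lt_log (Real.exp_pos a) hta
    rw [Real.log_exp, Real.log_mul (Real.exp_pos _).ne' hHkpos.ne', Real.log_exp] at this
    linarith [Real.log_le_log hHkpos hHk']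
  have h2 : κ * s + Real.log m ≤ b := by
    have := Real.log_le_log (mul_pos (Real.exp_pos _) hHkpos) htb
    rw [Real.log_mul (Real.exp_pos _).ne' hHkpos.ne', Real.log_exp, Real.log_exp] at this
    linarith [Real.log_le_log hm0 hHk]
  constructor
  · rw [hs₁, div_le_iff₀ hκ]; linarith
  · rw [hs₂, le_div_iff₀ hκ]; linarith

/-! ## §4 The window integral is `C · (log T' − log T)` -/

/-- **THE WINDOW INTEGRAL ON THE TORUS.**  Let `μ_T` be a left-invariant measure finite on compacts on the adelic torus
`T(𝔸_F) = torusInBorel F E c N` of `U(J_N)`, `w` a covering weight of the rational torus `T(F)` on it, `𝔎 ⊆ T(𝔸_F)`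
compact, `ρ : ℝ → T(𝔸_F)` a continuous ray along which the Borel height is homogeneous (`H(ρ(s) t) = e^{κ s} H(t)`,
`κ > 0`; hypotheses-first as in ★ H10b), and `S ⊆ ρ(ℝ) · 𝔎` a measurable torus Siegel set meeting every `T(F)`-orbit
(★ H9a). Then there is `C < ∞` with, for all `0 < T ≤ T'`,
`∫⁻ w(t) · 1_{T < H(t) ≤ T'} dμ_T = C · (log T' − log T)`:
the push-forward of `w μ_T` by `log ∘ H` is a translation-invariant Borel measure on `ℝ` finite on `(0, 1]` (§2, §3),
hence a multiple of Lebesgue measure (★ `Literature.MeasureTheory.Measure.measure_Ioc_eq_mul_of_forall_map_add_eq`).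
This is the source of the term linear in `log T` of Arthur's `J^T(f)` on `U(3)` (Arthur (1981), §2; Rogawski (1990), §2.1).
[cite: Arthur1981TraceFormulaInvariantForm, §2] [cite: Rogawski1990, §2.1 (p. 12)] -/
theorem exists_lintegral_weight_mul_indicator_window_eq (μT : Measure (torusInBorel F E c N))
    [μT.IsMulLeftInvariant] [IsFiniteMeasureOnCompacts μT] {w : torusInBorel F E c N → ℝ≥0∞}
    (hw : IsCoveringWeight ((rationalBorel F E c N).subgroupOf (torusInBorel F E c N)) w)
    {𝔎 : Set (torusInBorel F E c N)} (h𝔎 : IsCompact 𝔎)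
    {ρ : ℝ → torusInBorel F E c N} (hρc : Continuous ρ) {κ : ℝ} (hκ : 0 < κ)
    (hH : ∀ (s : ℝ) (t : torusInBorel F E c N),
      (borelHeight (((ρ s * t : torusInBorel F E c N) : borelAdelic F E c N) : (quasiSplit F E c N).Adelic) : ℝ) =
        Real.exp (κ * s) * borelHeight (((t : torusInBorel F E c N) : borelAdelic F E c N) : (quasiSplit F E c N).Adelic))
    {S : Set (torusInBorel F E c N)} (hSm : MeasurableSet S) (hS : S ⊆ Set.range ρ * 𝔎)
    (hcov : ∀ t : torusInBorel F E c N,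
      ∃ τ : (rationalBorel F E c N).subgroupOf (torusInBorel F E c N), τ • t ∈ S) :
    ∃ C : ℝ≥0∞, C ≠ ⊤ ∧ ∀ T T' : ℝ≥0, 0 < T → T ≤ T' →
      ∫⁻ t, w t * {t : torusInBorel F E c N |
          T < borelHeight (((t : torusInBorel F E c N) : borelAdelic F E c N) : (quasiSplit F E c N).Adelic) ∧
          borelHeight (((t : torusInBorel F E c N) : borelAdelic F E c N) : (quasiSplit F E c N).Adelic) ≤ T'}.indicator
          1 t ∂μT =
        C * ENNReal.ofReal (Real.log (T' : ℝ) - Real.log (T : ℝ)) := by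
  -- the logarithmic height `φ(t) = log H(t)` and the push-forward `L = φ_*(w μ_T)` on `ℝ`
  set φ : torusInBorel F E c N → ℝ := fun t =>
    Real.log (borelHeight (((t : torusInBorel F E c N) : borelAdelic F E c N) : (quasiSplit F E c N).Adelic) : ℝ)
    with hφdef
  have hHm : Measurable fun t : torusInBorel F E c N =>
      borelHeight (((t : torusInBorel F E c N) : borelAdelic F E c N) : (quasiSplit F E c N).Adelic) :=
    measurable_borelHeight.comp (measurable_subtype_coe.comp measurable_subtype_coe)
  have hφ : Measurable φ := Real.measurable_log.comp (measurable_coe_nnreal_real.comp hHm)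
  set L : Measure ℝ := (μT.withDensity w).map φ with hLdef
  -- `L(A) = ∫⁻ 1_{φ ∈ A} w`
  have hLA : ∀ {A : Set ℝ}, MeasurableSet A → L A = ∫⁻ t, (φ ⁻¹' A).indicator w t ∂μT := fun hA =>
    Literature.MeasureTheory.Measure.map_withDensity_apply_eq_lintegral_indicator μT φ w hφ hA
  -- the indicator integrals as weighted height integrals `∫⁻ 1_{H ∈ log⁻¹ A} · w`
  have hind : ∀ {A : Set ℝ}, MeasurableSet A → ∀ t : torusInBorel F E c N,
      (φ ⁻¹' A).indicator w t =
        ((Real.log ∘ ((↑) : ℝ≥0 → ℝ)) ⁻¹' A).indicator (1 : ℝ≥0 → ℝ≥0∞)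
          (borelHeight (((t : torusInBorel F E c N) : borelAdelic F E c N) : (quasiSplit F E c N).Adelic)) * w t := by
    intro A _ t
    by_cases ht : t ∈ φ ⁻¹' A
    · have ht' : borelHeight (((t : torusInBorel F E c N) : borelAdelic F E c N) : (quasiSplit F E c N).Adelic) ∈
          (Real.log ∘ ((↑) : ℝ≥0 → ℝ)) ⁻¹' A := ht
      rw [Set.indicator_of_mem ht, Set.indicator_of_mem ht', Pi.one_apply, one_mul]
    · have ht' : borelHeight (((t : torusInBorel F E c N) : borelAdelic F E c N) : (quasiSplit F E c N).Adelic) ∉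
          (Real.log ∘ ((↑) : ℝ≥0 → ℝ)) ⁻¹' A := ht
      rw [Set.indicator_of_notMem ht, Set.indicator_of_notMem ht', zero_mul]
  have hmeasA : ∀ {A : Set ℝ}, MeasurableSet A →
      Measurable (((Real.log ∘ ((↑) : ℝ≥0 → ℝ)) ⁻¹' A).indicator (1 : ℝ≥0 → ℝ≥0∞)) :=
    fun hA => measurable_one.indicator ((Real.measurable_log.comp measurable_coe_nnreal_real) hA)
  -- (ii)+(iii): translation invariance of `L` along the ray
  have hinv : ∀ u : ℝ, L.map (· + u) = L := by
    intro u
    ext A hA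
    rw [Measure.map_apply (measurable_add_const u) hA, hLA (measurable_add_const u hA), hLA hA]
    simp_rw [hind (measurable_add_const u hA), hind hA]
    -- `φ(ρ(u/κ) t) = φ t + u`
    have key := lintegral_weight_mul_comp_borelHeight_mul_left μT hw (hmeasA hA) (ρ (u / κ))
    rw [key]
    refine lintegral_congr fun t => ?_
    congr 1
    have hpos : 0 < (borelHeight (((t : torusInBorel F E c N) : borelAdelic F E c N) :
        (quasiSplit F E c N).Adelic) : ℝ) := NNReal.coe_pos.2 (borelHeight_pos _)
    have hlog : Real.log (borelHeight ((((ρ (u / κ) * t : torusInBorel F E c N)) : borelAdelic F E c N) :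
        (quasiSplit F E c N).Adelic) : ℝ) =
        Real.log (borelHeight (((t : torusInBorel F E c N) : borelAdelic F E c N) :
          (quasiSplit F E c N).Adelic) : ℝ) + u := by
      rw [hH, Real.log_mul (Real.exp_pos _).ne' hpos.ne', Real.log_exp, mul_div_cancel₀ u hκ.ne', add_comm]
    have hiff : borelHeight (((t : torusInBorel F E c N) : borelAdelic F E c N) : (quasiSplit F E c N).Adelic) ∈
        (Real.log ∘ ((↑) : ℝ≥0 → ℝ)) ⁻¹' ((fun x : ℝ => x + u) ⁻¹' A) ↔
        borelHeight ((((ρ (u / κ) * t : torusInBorel F E c N)) : borelAdelic F E c N) :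
          (quasiSplit F E c N).Adelic) ∈ (Real.log ∘ ((↑) : ℝ≥0 → ℝ)) ⁻¹' A := by
      simp only [Set.mem_preimage, Function.comp_apply, hlog]
    by_cases hmem : borelHeight (((t : torusInBorel F E c N) : borelAdelic F E c N) : (quasiSplit F E c N).Adelic) ∈
        (Real.log ∘ ((↑) : ℝ≥0 → ℝ)) ⁻¹' ((fun x : ℝ => x + u) ⁻¹' A)
    · rw [Set.indicator_of_mem hmem, Set.indicator_of_mem (hiff.1 hmem)]
      rfl
    · rw [Set.indicator_of_notMem hmem, Set.indicator_of_notMem (fun h => hmem (hiff.2 h))]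
  -- (iii): `L(0, 1] < ∞` by domination through the Siegel set
  have hfin : L (Set.Ioc 0 1) ≠ ⊤ := by
    rw [hLA measurableSet_Ioc]
    have hA' : MeasurableSet ((Real.log ∘ ((↑) : ℝ≥0 → ℝ)) ⁻¹' Set.Ioc (0 : ℝ) 1) :=
      (Real.measurable_log.comp measurable_coe_nnreal_real) measurableSet_Ioc
    have hle := lintegral_indicator_comp_borelHeight_mul_weight_le μT hw hSm hcov hA'
    have heq : ∫⁻ t, (φ ⁻¹' Set.Ioc (0 : ℝ) 1).indicator w t ∂μT =
        ∫⁻ t, {t : torusInBorel F E c N |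
          borelHeight (((t : torusInBorel F E c N) : borelAdelic F E c N) : (quasiSplit F E c N).Adelic) ∈
            (Real.log ∘ ((↑) : ℝ≥0 → ℝ)) ⁻¹' Set.Ioc (0 : ℝ) 1}.indicator 1 t * w t ∂μT := by
      refine lintegral_congr fun t => ?_
      rw [hind measurableSet_Ioc t]
      by_cases hmem : borelHeight (((t : torusInBorel F E c N) : borelAdelic F E c N) :
          (quasiSplit F E c N).Adelic) ∈ (Real.log ∘ ((↑) : ℝ≥0 → ℝ)) ⁻¹' Set.Ioc (0 : ℝ) 1
      · rw [Set.indicator_of_mem hmem, Set.indicator_of_mem (show t ∈ {t : torusInBorel F E c N |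
          borelHeight (((t : torusInBorel F E c N) : borelAdelic F E c N) : (quasiSplit F E c N).Adelic) ∈
            (Real.log ∘ ((↑) : ℝ≥0 → ℝ)) ⁻¹' Set.Ioc (0 : ℝ) 1} from hmem)]
        rfl
      · rw [Set.indicator_of_notMem hmem, Set.indicator_of_notMem (show t ∉ {t : torusInBorel F E c N |
          borelHeight (((t : torusInBorel F E c N) : borelAdelic F E c N) : (quasiSplit F E c N).Adelic) ∈
            (Real.log ∘ ((↑) : ℝ≥0 → ℝ)) ⁻¹' Set.Ioc (0 : ℝ) 1} from hmem)]
    rw [heq]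
    refine ne_top_of_le_ne_top ?_ hle
    obtain ⟨K, hK, hsub⟩ := exists_isCompact_siegel_inter_window_subset h𝔎 hρc hκ hH hS 0 1
    refine ne_top_of_le_ne_top (hK.measure_lt_top (μ := μT)).ne (measure_mono ?_)
    intro t ht
    refine hsub ⟨ht.1, ?_⟩
    have h2 : Real.log (borelHeight (((t : torusInBorel F E c N) : borelAdelic F E c N) :
        (quasiSplit F E c N).Adelic) : ℝ) ∈ Set.Ioc (0 : ℝ) 1 := ht.2
    have hpos : 0 < (borelHeight (((t : torusInBorel F E c N) : borelAdelic F E c N) :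
        (quasiSplit F E c N).Adelic) : ℝ) := NNReal.coe_pos.2 (borelHeight_pos _)
    constructor
    · have := Real.exp_lt_exp.2 h2.1
      rwa [Real.exp_log hpos] at this
    · have := Real.exp_le_exp.2 h2.2
      rwa [Real.exp_log hpos] at this
  refine ⟨L (Set.Ioc 0 1), hfin, fun T T' hT hTT' => ?_⟩
  have hmain := Literature.MeasureTheory.Measure.measure_Ioc_eq_mul_of_forall_map_add_eq L hinv hfin
    (Real.log (T : ℝ)) (Real.log (T' : ℝ))
  rw [hLA measurableSet_Ioc] at hmain
  rw [← hmain]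
  refine lintegral_congr fun t => ?_
  have hpos : 0 < (borelHeight (((t : torusInBorel F E c N) : borelAdelic F E c N) :
      (quasiSplit F E c N).Adelic) : ℝ) := NNReal.coe_pos.2 (borelHeight_pos _)
  have hT0 : 0 < (T : ℝ) := NNReal.coe_pos.2 hT
  have hiff : t ∈ {t : torusInBorel F E c N |
      T < borelHeight (((t : torusInBorel F E c N) : borelAdelic F E c N) : (quasiSplit F E c N).Adelic) ∧
      borelHeight (((t : torusInBorel F E c N) : borelAdelic F E c N) : (quasiSplit F E c N).Adelic) ≤ T'} ↔
      t ∈ φ ⁻¹' Set.Ioc (Real.log (T : ℝ)) (Real.log (T' : ℝ)) := by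
    simp only [Set.mem_setOf_eq, Set.mem_preimage, Set.mem_Ioc, hφdef]
    rw [← NNReal.coe_lt_coe, ← NNReal.coe_le_coe, Real.log_lt_log_iff hT0 hpos,
      Real.log_le_log_iff hpos (lt_of_lt_of_le hT0 (NNReal.coe_le_coe.2 hTT'))]
  by_cases ht : t ∈ φ ⁻¹' Set.Ioc (Real.log (T : ℝ)) (Real.log (T' : ℝ))
  · rw [Set.indicator_of_mem ht, Set.indicator_of_mem (hiff.2 ht), Pi.one_apply, mul_one]
  · rw [Set.indicator_of_notMem ht, Set.indicator_of_notMem (fun h => ht (hiff.1 h)), mul_zero]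

end Window


end UnitaryGroup

end Literature.NumberTheory.Automorphic
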